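import Mathlib
import HarnessLib

/-!
# Descent of ideals along flat ring maps (fpqc descent for quasi-coherent ideals, ring form)

Topic: `Literature/RingTheory/Flat`. Let `R → S` be a ring map and `I ⊆ S` an ideal. The two
coprojections `S ⇉ S ⊗_R S` pull `I` back to the ideals `I ⊗ S` (`I.map includeLeft`) and `S ⊗ I`
(`I.map includeRight`); a DESCENT DATUM on the closed subscheme `V(I) ⊆ Spec S` relative to
`Spec S → Spec R` is the equality of these two ideals (Grothendieck's fpqc descent, SGA 1 VIII;
The Stacks Project, Tag 023N / 03OK for quasi-coherent sheaves, here for ideal sheaves = closed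
subschemes, Tag 0245). This file proves the EFFECTIVITY half that needs only FLATNESS of `S`:

* `Ideal.le_map_comap_of_tmul_one_eq_zero` — if `S` is flat over `R` and `x ⊗ 1 = 0` in
  `S ⊗_R (S/I)`, then `x ∈ (I ∩ R)·S`;
* `Ideal.eq_map_comap_of_map_includeLeft_le` — **if `S` is `R`-flat and `I ⊗ S ⊆ S ⊗ I` in
  `S ⊗_R S`, then `I = (I ∩ R)·S`**: the ideal `I` descends to the ideal `I ∩ R` of `R`
  (its extension back to `S` is `I`). With faithful flatness the descended ideal is moreover
  unique (`Ideal.comap_map_of_faithfullyFlat`-type statements, Mathlib/tree), which is not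
  needed here.

Proof: `J := I ∩ R`; `R/J → S/I` is injective, hence so is `S ⊗_R (R/J) → S ⊗_R (S/I)` (`S` flat),
and `S ⊗_R (R/J) = S/JS` (`Algebra.TensorProduct.quotIdealMapEquivTensorQuot`); so the kernel of
`s ↦ s ⊗ 1̄`, `S → S ⊗_R (S/I)`, is `JS`. For `x ∈ I`, `x ⊗ 1 ∈ I ⊗ S ⊆ S ⊗ I` maps to `0` under
`S ⊗ S → S ⊗ (S/I)`, i.e. `x ⊗ 1̄ = 0`, so `x ∈ JS`.

References: [StacksProject] Tags 023N, 0245 (descent of quasi-coherent sheaves / closed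
subschemes along fpqc coverings); A. Grothendieck, SGA 1, Exp. VIII, Thm. 1.1, Cor. 1.9.
-/

noncomputable section

open TensorProduct Algebra.TensorProduct

namespace Literature.RingTheory.Flat

universe u v

variable {R : Type u} {S : Type v} [CommRing R] [CommRing S] [Algebra R S]

/-- The quotient map `R/(I ∩ R) → S/I` induced by `R → S` is injective. [folklore] -/
private theorem quotientMap_comap_injective (I : Ideal S) :
    Function.Injective (Ideal.quotientMapₐ I (Algebra.ofId R S)
      (le_of_eq (rfl : I.comap (algebraMap R S) = I.comap (Algebra.ofId R S)))) := by
  rw [injective_iff_map_eq_zero]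
  intro r hr
  obtain ⟨r, rfl⟩ := Ideal.Quotient.mk_surjective r
  rw [Ideal.Quotient.eq_zero_iff_mem, Ideal.mem_comap]
  have hr' : Ideal.Quotient.mk I (algebraMap R S r) = 0 := by
    simpa [Ideal.quotientMapₐ, Ideal.quotientMap_mk] using hr
  exact Ideal.Quotient.eq_zero_iff_mem.1 hr'

/-- **Kernel of `s ↦ s ⊗ 1̄`.** If `S` is flat over `R` and `I ⊆ S` is an ideal, an element
`x ∈ S` with `x ⊗ 1 = 0` in `S ⊗_R (S/I)` lies in the extension `(I ∩ R)·S` of the contraction of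
`I` (because `S ⊗_R (R/(I ∩ R)) = S/(I ∩ R)S` injects into `S ⊗_R (S/I)` by flatness).
[cite: StacksProject, Tag 023N] -/
theorem Ideal.le_map_comap_of_tmul_one_eq_zero [Module.Flat R S] (I : Ideal S) (x : S)
    (hx : x ⊗ₜ[R] (1 : S ⧸ I) = 0) :
    x ∈ (I.comap (algebraMap R S)).map (algebraMap R S) := by
  set J : Ideal R := I.comap (algebraMap R S) with hJ
  -- the injection `R/J → S/I` and its flat base change
  let u : (R ⧸ J) →ₐ[R] (S ⧸ I) := Ideal.quotientMapₐ I (Algebra.ofId R S) (le_of_eq (by rw [hJ]; rfl))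
  have hu : Function.Injective u := quotientMap_comap_injective I
  have hlt : Function.Injective (u.toLinearMap.lTensor S) :=
    Module.Flat.lTensor_preserves_injective_linearMap u.toLinearMap hu
  -- `S/JS ≅ S ⊗ R/J`
  let e := Algebra.TensorProduct.quotIdealMapEquivTensorQuot S J
  have hθ : u.toLinearMap.lTensor S (e (Ideal.Quotient.mk _ x)) = x ⊗ₜ[R] (1 : S ⧸ I) := by
    rw [Algebra.TensorProduct.quotIdealMapEquivTensorQuot_mk, LinearMap.lTensor_tmul]
    simp [u]
  have h0 : e (Ideal.Quotient.mk _ x) = 0 := hlt (by rw [hθ, hx, map_zero])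
  have h1 : Ideal.Quotient.mk (J.map (algebraMap R S)) x = 0 := by
    simpa using congrArg e.symm h0
  exact Ideal.Quotient.eq_zero_iff_mem.1 h1

/-- **Descent of an ideal along a flat ring map** (effectivity of fpqc descent for closed
subschemes, ring form). Let `S` be a flat `R`-algebra and `I ⊆ S` an ideal carrying a descent
datum: `I ⊗ S ⊆ S ⊗ I` inside `S ⊗_R S` (the images of `I` under the two coprojections
`includeLeft`, `includeRight` generate comparable — under symmetry, equal — ideals). Then `I` is
extended from `R`: `I = (I ∩ R)·S`. [cite: StacksProject, Tag 0245] -/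
theorem Ideal.eq_map_comap_of_map_includeLeft_le [Module.Flat R S] (I : Ideal S)
    (hI : I.map (Algebra.TensorProduct.includeLeft : S →ₐ[R] S ⊗[R] S) ≤
      I.map (Algebra.TensorProduct.includeRight : S →ₐ[R] S ⊗[R] S)) :
    I = (I.comap (algebraMap R S)).map (algebraMap R S) := by
  refine le_antisymm (fun x hx => ?_) Ideal.map_comap_le
  apply Ideal.le_map_comap_of_tmul_one_eq_zero I x
  -- `S ⊗ S → S ⊗ S/I` kills `S ⊗ I`, hence `I ⊗ S`, hence `x ⊗ 1`
  let φ : S ⊗[R] S →ₐ[R] S ⊗[R] (S ⧸ I) :=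
    Algebra.TensorProduct.map (AlgHom.id R S) (Ideal.Quotient.mkₐ R I)
  have hker : I.map (Algebra.TensorProduct.includeRight : S →ₐ[R] S ⊗[R] S) ≤
      RingHom.ker φ.toRingHom := by
    rw [Ideal.map_le_iff_le_comap]
    intro y hy
    rw [Ideal.mem_comap, RingHom.mem_ker]
    change φ ((1 : S) ⊗ₜ[R] y) = 0
    rw [Algebra.TensorProduct.map_tmul]
    simp [Ideal.Quotient.eq_zero_iff_mem.2 hy]
  have hx1 : x ⊗ₜ[R] (1 : S) ∈ I.map (Algebra.TensorProduct.includeLeft : S →ₐ[R] S ⊗[R] S) :=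
    Ideal.mem_map_of_mem _ hx
  have h := hker (hI hx1)
  rw [RingHom.mem_ker] at h
  change φ (x ⊗ₜ[R] (1 : S)) = 0 at h
  rwa [Algebra.TensorProduct.map_tmul, map_one] at h

/-- Symmetric form: with the descent datum as an EQUALITY `I ⊗ S = S ⊗ I`, a flat `S` and any
ideal `I ⊆ S`, `I = (I ∩ R)·S`. [cite: StacksProject, Tag 0245] -/
theorem Ideal.eq_map_comap_of_map_includeLeft_eq [Module.Flat R S] (I : Ideal S)
    (hI : I.map (Algebra.TensorProduct.includeLeft : S →ₐ[R] S ⊗[R] S) =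
      I.map (Algebra.TensorProduct.includeRight : S →ₐ[R] S ⊗[R] S)) :
    I = (I.comap (algebraMap R S)).map (algebraMap R S) :=
  Ideal.eq_map_comap_of_map_includeLeft_le I hI.le

/-- **Descent of ideals, existence and uniqueness for faithfully flat maps**: for `S` faithfully
flat over `R`, the ideals of `S` with descent datum `I ⊗ S = S ⊗ I` are exactly the extensions
`J·S` of ideals `J ⊆ R`, and `J = J·S ∩ R` (Mathlib `Ideal.comap_map_eq_self_of_faithfullyFlat`).
[cite: StacksProject, Tag 0245] -/
theorem Ideal.exists_unique_eq_map_of_map_includeLeft_eq [Module.FaithfullyFlat R S] (I : Ideal S)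
    (hI : I.map (Algebra.TensorProduct.includeLeft : S →ₐ[R] S ⊗[R] S) =
      I.map (Algebra.TensorProduct.includeRight : S →ₐ[R] S ⊗[R] S)) :
    ∃! J : Ideal R, I = J.map (algebraMap R S) := by
  refine ⟨I.comap (algebraMap R S), Ideal.eq_map_comap_of_map_includeLeft_eq I hI, fun J hJ => ?_⟩
  rw [hJ, Ideal.comap_map_eq_self_of_faithfullyFlat]

end Literature.RingTheory.Flat

end
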